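import Literature.NumberTheory.IwasawaTheory.CyclotomicTwoTowerOddPrimeSplitting
import Literature.NumberTheory.NumberFields.CyclicPrimePowerUniquePrimeOverRelative
import Literature.NumberTheory.IwasawaTheory.ZpExtensionNormKernelLayerPair
import Mathlib.Data.Nat.Factorization.PrimePow
import HarnessLib

/-!
# The EXACT decomposition of an odd prime in the cyclotomic `ℤ₂`-tower of `ℚ`:
# `g_n(ℓ) = 2^{min(n, m_ℓ)}` with `2^{m_ℓ + 3} ∥ ℓ² − 1` — complete splitting up to layer `m_ℓ`, then every prime stays inert
# (proved; no definition, no named fact)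

Topic `NumberTheory/IwasawaTheory` (namespace = path).  THEOREM-ONLY file, written by the prover seat `bsd-line-att-p3` g30 (cell `bsd-f1-sign2`;
`--supports` stmt-BirchSwinnertonDyer-22298; closes nothing).  Sequel of `CyclotomicTwoTowerOddPrimeSplitting` (`g_n(ℓ) = 2ⁿ ⟺ ℓ ≡ ±1 (mod 2^{n+2})`)
and `NumberFields/CyclicPrimePowerUniquePrimeOverRelative` (in a cyclic `p`-power tower decomposition stalls for ever once it stalls once).  `κ` is any
cyclotomic `ℤ₂`-extension of `ℚ`, `ℚ_n = κ.layer n`, `ℓ` an odd prime, `g_n(ℓ) = #{primes of 𝓞 ℚ_n above ℓ}`.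

* §1 arithmetic: `two_pow_succ_dvd_sq_sub_one_iff` — for odd `ℓ` and `k ≥ 2`: **`2^{k+1} ∣ ℓ² − 1 ⟺ 2^k ∣ ℓ − 1 ∨ 2^k ∣ ℓ + 1`**;
  `mod_two_pow_eq_iff_dvd_sq_sub_one` — `ℓ ≡ ±1 (mod 2^k) ⟺ 2^{k+1} ∣ ℓ² − 1`; `ncard_primesOver_layer_eq_two_pow_iff_dvd` —
  **`g_n(ℓ) = 2ⁿ ⟺ 2^{n+3} ∣ ℓ² − 1`**.
* §2 the tower count (any compatible algebra structure `ℚ_a → ℚ_b`): `ncard_primesOver_layer_mul` (`g_b(ℓ) = g_a(ℓ) · #{primes of ℚ_b above 𝔮}`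
  for any prime `𝔮 ∣ ℓ` of `ℚ_a`), `ncard_primesOver_layer_dvd` / `…_dvd_of_le` (`g_a ∣ g_b`), `ncard_primesOver_layer_dvd_finrank_mul`,
  `ncard_primesOver_eq_one_of_layer_eq`, `ncard_primesOver_layer_succ_dvd` (`g_{a+1} ∣ 2·g_a`), ★ `ncard_primesOver_layer_eq_of_stall`
  (**`g_{a+1}(ℓ) = g_a(ℓ) ⟹ g_b(ℓ) = g_a(ℓ)` for every `b ≥ a + 1`**).
* §3 ★ **`ncard_primesOver_layer_eq_two_pow_min`** — if `2^{m+3} ∣ ℓ² − 1` and `2^{m+4} ∤ ℓ² − 1` then **`g_n(ℓ) = 2^{min(n, m)}` for every `n`**;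
  `ncard_primesOver_layer_eq_two_pow_min_padicValNat` — the same with `m = ord₂(ℓ² − 1) − 3`; `ncard_primesOver_layer_eq_of_le` (`g_n = 2^m` for `n ≥ m`).

So `t_n = Σ_{ℓ ∣ d_K} 2^{min(n, ord₂(ℓ²−1)−3)}` in `ImaginaryQuadraticTwoTowerGenusRank` is explicit and stabilises at `n₀ = max_ℓ (ord₂(ℓ²−1)−3)` with the value
`Σ_{ℓ ∣ d_K} 2^{ord₂(ℓ²−1)−3}` — Ferrero's / Kida's number.

HONEST SCOPE: textbook (Washington §13.1: «each prime is finitely decomposed in `ℚ_∞`»); nothing here is specific to any summit; BSD is not proved by any of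
this.

## References
* L. C. Washington, *Introduction to Cyclotomic Fields*, 2nd ed. (1997), Thm. 2.13, §13.1. [Washington1997]
* B. Ferrero, Amer. J. Math. 102 (1980) 447–459, §2. [Ferrero1980AJM]
-/

set_option autoImplicit false

noncomputable section

open scoped NumberField
open NumberField IsDedekindDomain Field IntermediateField Module Ideal

namespace Literature.NumberTheory.IwasawaTheory

open Literature.NumberTheory.EllipticCurves Literature.NumberTheory.EllipticCurves.ZpExtension
  Literature.NumberTheory.GaloisRepresentations Literature.NumberTheory.NumberFields

/-! ## §1 `ℓ ≡ ±1 (mod 2^k) ⟺ 2^{k+1} ∣ ℓ² − 1` -/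

/-- For odd `ℓ` and `k ≥ 2`: **`2^{k+1} ∣ ℓ² − 1 ⟺ 2^k ∣ ℓ − 1 ∨ 2^k ∣ ℓ + 1`** (`ℓ² − 1 = (ℓ+1)(ℓ−1)` with `ℓ = 2t+1`:
`4·t(t+1)`, `t ⊥ t+1`). [cite: Washington1997, §13.1 (the primes of `ℚ_∞` above `ℓ`)] -/
theorem two_pow_succ_dvd_sq_sub_one_iff {ℓ k : ℕ} (hℓ : Odd ℓ) (hk : 2 ≤ k) :
    2 ^ (k + 1) ∣ ℓ ^ 2 - 1 ↔ (2 ^ k ∣ ℓ - 1 ∨ 2 ^ k ∣ ℓ + 1) := by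
  obtain ⟨t, rfl⟩ := hℓ
  obtain ⟨j, rfl⟩ : ∃ j, k = j + 2 := ⟨k - 2, by omega⟩
  have hsq : (2 * t + 1) ^ 2 - 1 = 4 * (t * (t + 1)) := by
    have : (2 * t + 1) ^ 2 = 4 * (t * (t + 1)) + 1 := by ring
    omega
  have h1 : 2 * t + 1 - 1 = 2 * t := by omega
  have h2 : 2 * t + 1 + 1 = 2 * (t + 1) := by ring
  have hpow : 2 ^ (j + 2 + 1) = 4 * 2 ^ (j + 1) := by ring
  have hpow' : 2 ^ (j + 2) = 2 * 2 ^ (j + 1) := by ring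
  rw [hsq, h1, h2, hpow, hpow', Nat.mul_dvd_mul_iff_left (by norm_num : 0 < 4), Nat.mul_dvd_mul_iff_left (by norm_num : 0 < 2),
    Nat.mul_dvd_mul_iff_left (by norm_num : 0 < 2)]
  have hcop : Nat.Coprime t (t + 1) := by
    rw [Nat.coprime_self_add_right]; exact Nat.coprime_one_right t
  exact hcop.isPrimePow_dvd_mul (Nat.prime_two.isPrimePow.pow (Nat.succ_ne_zero j))

/-- For odd `ℓ` and `k ≥ 2`: **`ℓ ≡ ±1 (mod 2^k) ⟺ 2^{k+1} ∣ ℓ² − 1`**. [cite: Washington1997, §13.1] -/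
theorem mod_two_pow_eq_iff_dvd_sq_sub_one {ℓ k : ℕ} (hℓ : Odd ℓ) (hk : 2 ≤ k) :
    (ℓ % 2 ^ k = 1 ∨ ℓ % 2 ^ k = 2 ^ k - 1) ↔ 2 ^ (k + 1) ∣ ℓ ^ 2 - 1 := by
  rw [two_pow_succ_dvd_sq_sub_one_iff hℓ hk]
  have hℓ1 : 1 ≤ ℓ := hℓ.pos
  have hM : 2 ≤ 2 ^ k := by
    calc 2 = 2 ^ 1 := by norm_num
      _ ≤ 2 ^ k := Nat.pow_le_pow_right two_pos (by omega)
  set M := 2 ^ k with hMdef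
  constructor
  · rintro (h | h)
    · left
      have := Nat.div_add_mod ℓ M
      exact ⟨ℓ / M, by omega⟩
    · right
      have := Nat.div_add_mod ℓ M
      exact ⟨ℓ / M + 1, by rw [mul_add, mul_one]; omega⟩
  · rintro (⟨c, hc⟩ | ⟨c, hc⟩)
    · left
      have : ℓ = M * c + 1 := by omega
      rw [this, Nat.mul_add_mod]
      exact Nat.mod_eq_of_lt (by omega)
    · right
      have hc1 : 1 ≤ c := by
        by_contra h0
        have : c = 0 := by omega
        rw [this, mul_zero] at hc
        omega
      have : ℓ = M * (c - 1) + (M - 1) := by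
        zify [hc1, (by omega : 1 ≤ M), hℓ1] at hc ⊢
        linear_combination hc
      rw [this, Nat.mul_add_mod]
      exact Nat.mod_eq_of_lt (by omega)

variable {κ : ZpExtension ℚ 2} (hκ : κ.IsCyclotomic)

include hκ in
/-- **`g_n(ℓ) = 2ⁿ ⟺ 2^{n+3} ∣ ℓ² − 1`** for an odd prime `ℓ` (complete splitting in `ℚ_n`). [cite: Washington1997, Thm. 2.13 and §13.1] -/
theorem ncard_primesOver_layer_eq_two_pow_iff_dvd (n : ℕ) {ℓ : ℕ} (hℓ : ℓ.Prime) (hℓ2 : ℓ ≠ 2) [NumberField ↥(κ.layer n)] :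
    ((Ideal.span {(ℓ : ℤ)}).primesOver (𝓞 ↥(κ.layer n))).ncard = 2 ^ n ↔ 2 ^ (n + 3) ∣ ℓ ^ 2 - 1 := by
  have h := ncard_primesOver_layer_eq_two_pow_iff hκ n hℓ hℓ2
  rw [← mod_two_pow_eq_iff_dvd_sq_sub_one (hℓ.odd_of_ne_two hℓ2) (by omega : 2 ≤ n + 2)]
  exact h

/-! ## §2 Counting along the tower: `g_b = g_a · g(ℚ_b/𝔮)`, divisibility, and «a stall is for ever»

The relative layer `ℚ_b/ℚ_a` carries ANY algebra structure compatible with `ℚ` (`IsScalarTower ℚ ℚ_a ℚ_b`; e.g. the inclusion of intermediate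
fields), as in the tree's `ZpExtensionNormKernelLayerPair`. -/

section Tower

variable {a b : ℕ} [Algebra ↥(κ.layer a) ↥(κ.layer b)] [IsScalarTower ℚ ↥(κ.layer a) ↥(κ.layer b)]

omit [IsScalarTower ℚ ↥(κ.layer a) ↥(κ.layer b)] in
/-- **`g_b(ℓ) = g_a(ℓ) · #{primes of ℚ_b above 𝔮}`** for any prime `𝔮 ∣ ℓ` of `ℚ_a` (both layers are Galois over `ℚ`).
[cite: NeukirchANT1999, Ch. I §9 (9.1)–(9.2)] -/
theorem ncard_primesOver_layer_mul {ℓ : ℕ} [NumberField ↥(κ.layer a)] [NumberField ↥(κ.layer b)]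
    (𝔮 : Ideal (𝓞 ↥(κ.layer a))) [𝔮.IsPrime] [𝔮.LiesOver (Ideal.span {(ℓ : ℤ)})] :
    ((Ideal.span {(ℓ : ℤ)}).primesOver (𝓞 ↥(κ.layer a))).ncard * (𝔮.primesOver (𝓞 ↥(κ.layer b))).ncard =
      ((Ideal.span {(ℓ : ℤ)}).primesOver (𝓞 ↥(κ.layer b))).ncard := by
  haveI : IsGalois ℚ ↥(κ.layer a) := κ.isGalois_layer_holds a
  haveI : IsGalois ℚ ↥(κ.layer b) := κ.isGalois_layer_holds b
  exact Ideal.ncard_primesOver_mul_ncard_primesOver 𝔮 (↥(κ.layer a) ≃ₐ[ℚ] ↥(κ.layer a)) (𝓞 ↥(κ.layer b))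
    (↥(κ.layer b) ≃ₐ[ℚ] ↥(κ.layer b))

omit [IsScalarTower ℚ ↥(κ.layer a) ↥(κ.layer b)] in
/-- **`g_a(ℓ) ∣ g_b(ℓ)`** (whenever `ℚ_b` is a `ℚ_a`-algebra). [cite: NeukirchANT1999, Ch. I §9 (9.2)] -/
theorem ncard_primesOver_layer_dvd {ℓ : ℕ} (hℓ : ℓ.Prime) [NumberField ↥(κ.layer a)] [NumberField ↥(κ.layer b)] :
    ((Ideal.span {(ℓ : ℤ)}).primesOver (𝓞 ↥(κ.layer a))).ncard ∣ ((Ideal.span {(ℓ : ℤ)}).primesOver (𝓞 ↥(κ.layer b))).ncard := by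
  haveI : Fact ℓ.Prime := ⟨hℓ⟩
  haveI : (Ideal.span {(ℓ : ℤ)}).IsMaximal := Int.ideal_span_isMaximal_of_prime ℓ
  obtain ⟨⟨𝔮, h𝔮, h𝔮ℓ⟩⟩ := (Ideal.span {(ℓ : ℤ)}).nonempty_primesOver (S := 𝓞 ↥(κ.layer a))
  haveI := h𝔮
  haveI := h𝔮ℓ
  exact ⟨_, (ncard_primesOver_layer_mul (κ := κ) 𝔮).symm⟩

/-- **`g_b(ℓ) ∣ [ℚ_b : ℚ_a] · g_a(ℓ)`.** [cite: NeukirchANT1999, Ch. I §9 (9.2)] -/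
theorem ncard_primesOver_layer_dvd_finrank_mul {ℓ : ℕ} (hℓ : ℓ.Prime) [NumberField ↥(κ.layer a)] [NumberField ↥(κ.layer b)] :
    ((Ideal.span {(ℓ : ℤ)}).primesOver (𝓞 ↥(κ.layer b))).ncard ∣
      Module.finrank ↥(κ.layer a) ↥(κ.layer b) * ((Ideal.span {(ℓ : ℤ)}).primesOver (𝓞 ↥(κ.layer a))).ncard := by
  haveI : Fact ℓ.Prime := ⟨hℓ⟩
  haveI : (Ideal.span {(ℓ : ℤ)}).IsMaximal := Int.ideal_span_isMaximal_of_prime ℓ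
  haveI : IsGalois ↥(κ.layer a) ↥(κ.layer b) := isGalois_layer_layer κ
  obtain ⟨⟨𝔮, h𝔮, h𝔮ℓ⟩⟩ := (Ideal.span {(ℓ : ℤ)}).nonempty_primesOver (S := 𝓞 ↥(κ.layer a))
  haveI := h𝔮
  haveI := h𝔮ℓ
  have h𝔮0 : 𝔮 ≠ ⊥ := Ideal.ne_bot_of_liesOver_of_ne_bot
    (by rw [Ne, Ideal.span_singleton_eq_bot]; exact_mod_cast hℓ.ne_zero : (Ideal.span {(ℓ : ℤ)}) ≠ ⊥) 𝔮
  haveI : 𝔮.IsMaximal := h𝔮.isMaximal h𝔮0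
  rw [← ncard_primesOver_layer_mul (κ := κ) 𝔮, mul_comm (Module.finrank _ _)]
  exact Nat.mul_dvd_mul_left _ (ncard_primesOver_dvd_finrank_of_base ↥(κ.layer a) ↥(κ.layer b) 𝔮)

omit [IsScalarTower ℚ ↥(κ.layer a) ↥(κ.layer b)] in
/-- **If `g_b(ℓ) = g_a(ℓ)` then every prime `𝔮 ∣ ℓ` of `ℚ_a` has exactly one prime of `ℚ_b` above it.** [cite: NeukirchANT1999, Ch. I §9 (9.2)] -/
theorem ncard_primesOver_eq_one_of_layer_eq {ℓ : ℕ} (hℓ : ℓ.Prime) [NumberField ↥(κ.layer a)] [NumberField ↥(κ.layer b)]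
    (h : ((Ideal.span {(ℓ : ℤ)}).primesOver (𝓞 ↥(κ.layer b))).ncard = ((Ideal.span {(ℓ : ℤ)}).primesOver (𝓞 ↥(κ.layer a))).ncard)
    (𝔮 : Ideal (𝓞 ↥(κ.layer a))) [𝔮.IsPrime] [𝔮.LiesOver (Ideal.span {(ℓ : ℤ)})] :
    (𝔮.primesOver (𝓞 ↥(κ.layer b))).ncard = 1 := by
  haveI : Fact ℓ.Prime := ⟨hℓ⟩
  haveI : (Ideal.span {(ℓ : ℤ)}).IsMaximal := Int.ideal_span_isMaximal_of_prime ℓ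
  have hmul := ncard_primesOver_layer_mul (κ := κ) (b := b) (ℓ := ℓ) 𝔮
  rw [h] at hmul
  have hpos : 0 < ((Ideal.span {(ℓ : ℤ)}).primesOver (𝓞 ↥(κ.layer a))).ncard :=
    (Set.ncard_pos (IsDedekindDomain.primesOver_finite _ _)).mpr ⟨𝔮, ‹_›, ‹_›⟩
  exact Nat.eq_of_mul_eq_mul_left hpos (hmul.trans (mul_one _).symm)

end Tower

include hκ in
/-- **`g_{a+1}(ℓ) ∣ 2 · g_a(ℓ)`** (`[ℚ_{a+1} : ℚ_a] = 2`; the inclusion as algebra structure). [cite: Washington1997, §13.1] -/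
theorem ncard_primesOver_layer_succ_dvd (a : ℕ) {ℓ : ℕ} (hℓ : ℓ.Prime) [NumberField ↥(κ.layer a)] [NumberField ↥(κ.layer (a + 1))] :
    ((Ideal.span {(ℓ : ℤ)}).primesOver (𝓞 ↥(κ.layer (a + 1)))).ncard ∣ 2 * ((Ideal.span {(ℓ : ℤ)}).primesOver (𝓞 ↥(κ.layer a))).ncard := by
  have _ := hκ
  have ha1 : a ≤ a + 1 := Nat.le_add_right a 1
  letI : Algebra ↥(κ.layer a) ↥(κ.layer (a + 1)) := (IntermediateField.inclusion (κ.layer_mono ha1)).toRingHom.toAlgebra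
  haveI : IsScalarTower ℚ ↥(κ.layer a) ↥(κ.layer (a + 1)) := IsScalarTower.of_algebraMap_eq fun _ => rfl
  have h := ncard_primesOver_layer_dvd_finrank_mul (κ := κ) (a := a) (b := a + 1) hℓ
  rwa [finrank_layer_layer κ ha1, Nat.add_sub_cancel_left, pow_one] at h

include hκ in
/-- **`g_a(ℓ) ∣ g_b(ℓ)` for `a ≤ b`** (the inclusion `ℚ_a ⊆ ℚ_b`). [cite: NeukirchANT1999, Ch. I §9 (9.2)] -/
theorem ncard_primesOver_layer_dvd_of_le {a b : ℕ} (hab : a ≤ b) {ℓ : ℕ} (hℓ : ℓ.Prime) [NumberField ↥(κ.layer a)]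
    [NumberField ↥(κ.layer b)] :
    ((Ideal.span {(ℓ : ℤ)}).primesOver (𝓞 ↥(κ.layer a))).ncard ∣ ((Ideal.span {(ℓ : ℤ)}).primesOver (𝓞 ↥(κ.layer b))).ncard := by
  have _ := hκ
  letI : Algebra ↥(κ.layer a) ↥(κ.layer b) := (IntermediateField.inclusion (κ.layer_mono hab)).toRingHom.toAlgebra
  haveI : IsScalarTower ℚ ↥(κ.layer a) ↥(κ.layer b) := IsScalarTower.of_algebraMap_eq fun _ => rfl
  exact ncard_primesOver_layer_dvd (κ := κ) hℓ

/-- **If every prime `𝔮 ∣ ℓ` of `ℚ_a` has ONE prime of `ℚ_b` above it, then `g_b(ℓ) = g_a(ℓ)`.** [cite: NeukirchANT1999, Ch. I §9 (9.2)] -/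
theorem ncard_primesOver_layer_eq_of_forall_eq_one {a b : ℕ} [Algebra ↥(κ.layer a) ↥(κ.layer b)] {ℓ : ℕ} (hℓ : ℓ.Prime)
    [NumberField ↥(κ.layer a)] [NumberField ↥(κ.layer b)]
    (h : ∀ 𝔮 : Ideal (𝓞 ↥(κ.layer a)), 𝔮.IsPrime → 𝔮.LiesOver (Ideal.span {(ℓ : ℤ)}) → (𝔮.primesOver (𝓞 ↥(κ.layer b))).ncard = 1) :
    ((Ideal.span {(ℓ : ℤ)}).primesOver (𝓞 ↥(κ.layer b))).ncard = ((Ideal.span {(ℓ : ℤ)}).primesOver (𝓞 ↥(κ.layer a))).ncard := by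
  haveI : Fact ℓ.Prime := ⟨hℓ⟩
  haveI : (Ideal.span {(ℓ : ℤ)}).IsMaximal := Int.ideal_span_isMaximal_of_prime ℓ
  obtain ⟨⟨𝔮, h𝔮, h𝔮ℓ⟩⟩ := (Ideal.span {(ℓ : ℤ)}).nonempty_primesOver (S := 𝓞 ↥(κ.layer a))
  haveI := h𝔮
  haveI := h𝔮ℓ
  rw [← ncard_primesOver_layer_mul (κ := κ) (b := b) (ℓ := ℓ) 𝔮, h 𝔮 h𝔮 h𝔮ℓ, mul_one]

include hκ in
/-- ★ **A stall is for ever: `g_{a+1}(ℓ) = g_a(ℓ) ⟹ g_b(ℓ) = g_a(ℓ)` for every `b ≥ a + 1`.**  Every prime `𝔮 ∣ ℓ` of `ℚ_a` has exactly one prime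
above it in `ℚ_{a+1}`, hence — `Gal(ℚ_b/ℚ_a)` being cyclic of order `2^{b−a}` — exactly one prime above it in `ℚ_b`
(`ncard_primesOver_eq_one_of_isCyclic_of_base`); then `g_b = g_a`. [cite: Washington1997, §13.1 (finitely decomposed, then inert)]
[cite: Marcus2018, Ch. 4 Thm. 28] -/
theorem ncard_primesOver_layer_eq_of_stall {a b : ℕ} (hb : a + 1 ≤ b) {ℓ : ℕ} (hℓ : ℓ.Prime) [NumberField ↥(κ.layer a)]
    [NumberField ↥(κ.layer (a + 1))] [NumberField ↥(κ.layer b)]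
    (hstall : ((Ideal.span {(ℓ : ℤ)}).primesOver (𝓞 ↥(κ.layer (a + 1)))).ncard = ((Ideal.span {(ℓ : ℤ)}).primesOver (𝓞 ↥(κ.layer a))).ncard) :
    ((Ideal.span {(ℓ : ℤ)}).primesOver (𝓞 ↥(κ.layer b))).ncard = ((Ideal.span {(ℓ : ℤ)}).primesOver (𝓞 ↥(κ.layer a))).ncard := by
  have _ := hκ
  have hab : a ≤ b := le_trans (Nat.le_add_right a 1) hb
  have ha1 : a ≤ a + 1 := Nat.le_add_right a 1
  -- the tower `ℚ_a ⊆ ℚ_{a+1} ⊆ ℚ_b`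
  let fA1 : ↥(κ.layer a) →ₐ[ℚ] ↥(κ.layer (a + 1)) := IntermediateField.inclusion (κ.layer_mono ha1)
  let f1B : ↥(κ.layer (a + 1)) →ₐ[ℚ] ↥(κ.layer b) := IntermediateField.inclusion (κ.layer_mono hb)
  letI algA1 : Algebra ↥(κ.layer a) ↥(κ.layer (a + 1)) := fA1.toRingHom.toAlgebra
  letI alg1B : Algebra ↥(κ.layer (a + 1)) ↥(κ.layer b) := f1B.toRingHom.toAlgebra
  letI algAB : Algebra ↥(κ.layer a) ↥(κ.layer b) := (f1B.comp fA1).toRingHom.toAlgebra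
  haveI : IsScalarTower ℚ ↥(κ.layer a) ↥(κ.layer b) := IsScalarTower.of_algebraMap_eq fun q => ((f1B.comp fA1).commutes q).symm
  haveI : IsScalarTower ℚ ↥(κ.layer a) ↥(κ.layer (a + 1)) := IsScalarTower.of_algebraMap_eq fun q => (fA1.commutes q).symm
  haveI : IsScalarTower ↥(κ.layer a) ↥(κ.layer (a + 1)) ↥(κ.layer b) := IsScalarTower.of_algebraMap_eq fun _ => rfl
  haveI : IsGalois ↥(κ.layer a) ↥(κ.layer b) := isGalois_layer_layer κ
  haveI : IsCyclic (↥(κ.layer b) ≃ₐ[↥(κ.layer a)] ↥(κ.layer b)) := isCyclic_aut_layer_layer' κ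
  have hcard : Module.finrank ↥(κ.layer a) ↥(κ.layer b) = 2 ^ (b - a) := finrank_layer_layer κ hab
  have hM : 1 < Module.finrank ↥(κ.layer a) ↥(κ.layer (a + 1)) := by
    rw [finrank_layer_layer κ ha1, Nat.add_sub_cancel_left, pow_one]; exact one_lt_two
  refine ncard_primesOver_layer_eq_of_forall_eq_one (κ := κ) hℓ fun 𝔮 h𝔮 h𝔮ℓ => ?_
  have hℓ0 : (Ideal.span {(ℓ : ℤ)}) ≠ ⊥ := by
    rw [Ne, Ideal.span_singleton_eq_bot]; exact_mod_cast hℓ.ne_zero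
  haveI : 𝔮.IsMaximal := h𝔮.isMaximal (Ideal.ne_bot_of_liesOver_of_ne_bot hℓ0 𝔮)
  have hone1 : (𝔮.primesOver (𝓞 ↥(κ.layer (a + 1)))).ncard = 1 := ncard_primesOver_eq_one_of_layer_eq (κ := κ) hℓ hstall 𝔮
  exact ncard_primesOver_eq_one_of_isCyclic_of_base ↥(κ.layer a) ↥(κ.layer b) ↥(κ.layer (a + 1)) Nat.prime_two hcard hM 𝔮 hone1

/-! ## §3 `g_n(ℓ) = 2^{min(n, m)}` -/

include hκ in
/-- ★ **The exact decomposition law: if `2^{m+3} ∣ ℓ² − 1` and `2^{m+4} ∤ ℓ² − 1` (i.e. `m = ord₂(ℓ²−1) − 3`), then `g_n(ℓ) = 2^{min(n, m)}` for every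
`n`** — complete splitting up to layer `m` (`CyclotomicTwoTowerOddPrimeSplitting`), no complete splitting at layer `m+1`, so `g_{m+1} = g_m` (`g_{m+1} ∣ 2 g_m`,
`g_m ∣ g_{m+1}`), and the stall propagates (§2). [cite: Washington1997, §13.1 (the primes of `ℚ_∞` above `ℓ`)] [cite: Ferrero1980AJM, §2] -/
theorem ncard_primesOver_layer_eq_two_pow_min {ℓ : ℕ} (hℓ : ℓ.Prime) (hℓ2 : ℓ ≠ 2) {m : ℕ} (hm : 2 ^ (m + 3) ∣ ℓ ^ 2 - 1)
    (hm' : ¬ 2 ^ (m + 4) ∣ ℓ ^ 2 - 1) (n : ℕ) [NumberField ↥(κ.layer n)] :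
    ((Ideal.span {(ℓ : ℤ)}).primesOver (𝓞 ↥(κ.layer n))).ncard = 2 ^ min n m := by
  haveI : ∀ k, NumberField ↥(κ.layer k) := fun k =>
    haveI : FiniteDimensional ℚ ↥(κ.layer k) := κ.finiteDimensional_layer_holds k
    NumberField.of_module_finite ℚ _
  rcases le_or_gt n m with hnm | hnm
  · -- complete splitting at layer `n ≤ m`
    rw [min_eq_left hnm, ncard_primesOver_layer_eq_two_pow_iff_dvd hκ n hℓ hℓ2]
    exact (pow_dvd_pow 2 (by omega : n + 3 ≤ m + 3)).trans hm
  · rw [min_eq_right hnm.le]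
    -- `g_m = 2^m`, `g_{m+1} ≠ 2^{m+1}`, `g_m ∣ g_{m+1} ∣ 2 g_m` ⟹ `g_{m+1} = g_m`
    have hgm : ((Ideal.span {(ℓ : ℤ)}).primesOver (𝓞 ↥(κ.layer m))).ncard = 2 ^ m :=
      (ncard_primesOver_layer_eq_two_pow_iff_dvd hκ m hℓ hℓ2).mpr hm
    have hgm1 : ((Ideal.span {(ℓ : ℤ)}).primesOver (𝓞 ↥(κ.layer (m + 1)))).ncard ≠ 2 ^ (m + 1) := fun h =>
      hm' ((ncard_primesOver_layer_eq_two_pow_iff_dvd hκ (m + 1) hℓ hℓ2).mp h)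
    have h1 := ncard_primesOver_layer_dvd_of_le hκ (Nat.le_succ m) hℓ
    have h2 := ncard_primesOver_layer_succ_dvd hκ m hℓ
    rw [hgm] at h1 h2
    have hstall : ((Ideal.span {(ℓ : ℤ)}).primesOver (𝓞 ↥(κ.layer (m + 1)))).ncard =
        ((Ideal.span {(ℓ : ℤ)}).primesOver (𝓞 ↥(κ.layer m))).ncard := by
      rw [hgm]
      -- divisors of `2^{m+1}` that are multiples of `2^m`: `2^m` or `2^{m+1}`
      have h2' : ((Ideal.span {(ℓ : ℤ)}).primesOver (𝓞 ↥(κ.layer (m + 1)))).ncard ∣ 2 ^ (m + 1) := by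
        rw [pow_succ, mul_comm]; exact h2
      obtain ⟨i, hi, hgi⟩ := (Nat.dvd_prime_pow Nat.prime_two).mp h2'
      rw [hgi] at h1 hgm1 ⊢
      have him : m ≤ i := (Nat.pow_dvd_pow_iff_le_right one_lt_two).mp h1
      have : i ≠ m + 1 := fun h => hgm1 (by rw [h])
      have : i = m := by omega
      rw [this]
    rw [ncard_primesOver_layer_eq_of_stall hκ (by omega : m + 1 ≤ n) hℓ hstall, hgm]

include hκ in
/-- **`g_n(ℓ) = 2^{min(n, ord₂(ℓ² − 1) − 3)}`** for every odd prime `ℓ` and every `n` (`8 ∣ ℓ² − 1`, so `ord₂(ℓ²−1) ≥ 3`).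
[cite: Washington1997, §13.1] [cite: Ferrero1980AJM, §2] -/
theorem ncard_primesOver_layer_eq_two_pow_min_padicValNat {ℓ : ℕ} (hℓ : ℓ.Prime) (hℓ2 : ℓ ≠ 2) (n : ℕ) [NumberField ↥(κ.layer n)] :
    ((Ideal.span {(ℓ : ℤ)}).primesOver (𝓞 ↥(κ.layer n))).ncard = 2 ^ min n (padicValNat 2 (ℓ ^ 2 - 1) - 3) := by
  haveI : Fact (Nat.Prime 2) := ⟨Nat.prime_two⟩
  have hodd : Odd ℓ := hℓ.odd_of_ne_two hℓ2
  have hpos : 0 < ℓ ^ 2 - 1 := by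
    have : 2 ^ 2 ≤ ℓ ^ 2 := Nat.pow_le_pow_left hℓ.two_le 2
    omega
  have hne : ℓ ^ 2 - 1 ≠ 0 := hpos.ne'
  -- `8 ∣ ℓ² − 1`
  have h8 : 2 ^ 3 ∣ ℓ ^ 2 - 1 := by
    rw [show (3 : ℕ) = 2 + 1 by norm_num, ← mod_two_pow_eq_iff_dvd_sq_sub_one hodd le_rfl]
    have := Nat.odd_iff.mp hodd
    omega
  have h3 : 3 ≤ padicValNat 2 (ℓ ^ 2 - 1) := (padicValNat_dvd_iff_le hne).mp h8
  set v := padicValNat 2 (ℓ ^ 2 - 1) with hv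
  refine ncard_primesOver_layer_eq_two_pow_min hκ hℓ hℓ2 (m := v - 3) ?_ ?_ n
  · rw [show v - 3 + 3 = v by omega]
    exact pow_padicValNat_dvd
  · rw [show v - 3 + 4 = v + 1 by omega, padicValNat_dvd_iff_le hne]
    omega

include hκ in
/-- **For `n ≥ ord₂(ℓ² − 1) − 3` the count is stationary: `g_n(ℓ) = 2^{ord₂(ℓ²−1)−3}`.** [cite: Washington1997, §13.1] -/
theorem ncard_primesOver_layer_eq_of_le {ℓ : ℕ} (hℓ : ℓ.Prime) (hℓ2 : ℓ ≠ 2) {n : ℕ} (hn : padicValNat 2 (ℓ ^ 2 - 1) - 3 ≤ n)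
    [NumberField ↥(κ.layer n)] :
    ((Ideal.span {(ℓ : ℤ)}).primesOver (𝓞 ↥(κ.layer n))).ncard = 2 ^ (padicValNat 2 (ℓ ^ 2 - 1) - 3) := by
  rw [ncard_primesOver_layer_eq_two_pow_min_padicValNat hκ hℓ hℓ2 n, min_eq_right hn]

end Literature.NumberTheory.IwasawaTheory

end
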